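import Mathlib
import Literature.Computability.AlgebraicComplexity.DivisionSLP
import Literature.Computability.AlgebraicComplexity.NonscalarComputation
import Literature.Computability.AlgebraicComplexity.NonscalarBilinearRank
import Literature.Computability.AlgebraicComplexity.NonscalarBaurStrassen
import Literature.Computability.AlgebraicComplexity.MatrixMultiplicationExponent
import Literature.Computability.AlgebraicComplexity.SymmetrizedMatMul

/-!
# Sketch — crux `DerivationsBoundOmega` (stmt-MatrixMultiplication-15940), idea `cubic-jet`

First-lemma signatures for the idea card `idea-cubic-jet.md` (crux-ideate round 1, ideator 1).
Nothing is proved here; the point is that the statements elaborate over existing declarations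
(`Derivable`, `IsNonscalarSeq`, `freeSpan`, `homogeneousComponent`, `symmetrizedMatMulPoly`,
`tensorRank`, `matMulTensor`, `omega`).
-/

open MvPolynomial Literature.Computability.AlgebraicComplexity

-- the tree's namespace repeats a component by design
set_option linter.dupNamespace false

noncomputable section

namespace Summit.MatrixMultiplication.MatrixMultiplication.Cruxes.DerivationsBoundOmega.CubicJet

/-- The function field `ℂ(Z)` of the generic `n × m'` matrix `Z = [X | Y]` — the "tautological
generic point": every nonzero polynomial in the entries of `Z` is a unit here. -/
abbrev GenField (n m' : ℕ) : Type := FractionRing (MvPolynomial (Fin n × Fin m') ℂ)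

/-- `det (Ξ + T)`: the determinant of the generic leading `n × n` block `Ξ = (x_{ij})` (constants
from the function field) shifted by NEW variables `T = (t_{ij})`; a polynomial in `T` over `ℂ(Z)`.
Its homogeneous component of degree `d` in `T` is the `d`-th Taylor coefficient of `det` at the
generic point. -/
def shiftedDet (n m' : ℕ) (h : n ≤ m') : MvPolynomial (Fin n × Fin n) (GenField n m') :=
  Matrix.det (Matrix.of fun i j : Fin n =>
    C (algebraMap (MvPolynomial (Fin n × Fin m') ℂ) (GenField n m') (X (i, Fin.castLE h j))) +
      X (i, j))

/-- FIRST LEMMA of the line (jet transport at order 3 over the function field = BCS 1997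
Thm. (7.1) with `d = 3`, `λ` = the generic point, in the tree's currencies `Derivable` (total count,
divisions, over `Frac ℂ[Z]`) → `IsNonscalarSeq` (division-free, nonscalar, over the FIELD `ℂ(Z)`)):
a derivation of `det X` of length `s` yields ONE nonscalar sequence of length `≤ 3 s` in the new
variables `T` whose cost-free span contains the Taylor coefficients of degrees `1, 2, 3` of `det` at
the generic point. -/
def JetTransport : Prop :=
  ∀ (n m' : ℕ) (h : n ≤ m') (s : ℕ),
    Derivable ℂ s
      (Set.range fun p : Fin n × Fin m' =>
        algebraMap (MvPolynomial (Fin n × Fin m') ℂ) (GenField n m') (X p))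
      {algebraMap (MvPolynomial (Fin n × Fin m') ℂ) (GenField n m')
        (Matrix.det (Matrix.of fun i j : Fin n => X (i, Fin.castLE h j)))} →
    ∃ gs : List (MvPolynomial (Fin n × Fin n) (GenField n m')),
      IsNonscalarSeq gs ∧ gs.length ≤ 3 * s ∧
        ∀ d ≤ 3, 1 ≤ d → homogeneousComponent d (shiftedDet n m' h) ∈ freeSpan {x | x ∈ gs}

/-- The same lemma in Literature generality (what a prover would actually land under
`Literature/Computability/AlgebraicComplexity/`): BCS Thm. (7.1) for every order `d`, every finite
set of target POLYNOMIALS, at the tautological generic point. -/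
def TaylorTransport : Prop :=
  ∀ (σ : Type) [Fintype σ] [DecidableEq σ] (s d : ℕ) (B : Finset (MvPolynomial σ ℂ)),
    Derivable ℂ s
      (Set.range fun i : σ =>
        algebraMap (MvPolynomial σ ℂ) (FractionRing (MvPolynomial σ ℂ)) (X i))
      ((algebraMap (MvPolynomial σ ℂ) (FractionRing (MvPolynomial σ ℂ))) '' (↑B : Set _)) →
    ∃ gs : List (MvPolynomial σ (FractionRing (MvPolynomial σ ℂ))),
      IsNonscalarSeq gs ∧ gs.length ≤ d.choose 2 * s ∧
        ∀ b ∈ B, ∀ j ≤ d,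
          homogeneousComponent j
              (aeval (fun i : σ =>
                C (algebraMap (MvPolynomial σ ℂ) (FractionRing (MvPolynomial σ ℂ)) (X i)) + X i) b) ∈
            freeSpan {x | x ∈ gs}

/-- Second step (shape only): from the cubic Taylor coefficient of `det` to `tr(M³)` — factor out
`det Ξ`, substitute `T := Ξ M` (cost-free), `[det(1 + M)]_d = ± c_{n-d}(−M)`
(`FLPowTrace.homogeneousComponent_det_one_sub`) and LeVerrier/Newton
`tr(M³) = −3c_{n−3} + 3c_{n−1}c_{n−2} − c_{n−1}³` (3 more products). -/
def CubicToTraceCube : Prop :=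
  ∀ (n m' : ℕ) (h : n ≤ m') (gs : List (MvPolynomial (Fin n × Fin n) (GenField n m'))),
    IsNonscalarSeq gs →
    (∀ d ≤ 3, 1 ≤ d → homogeneousComponent d (shiftedDet n m' h) ∈ freeSpan {x | x ∈ gs}) →
    ∃ gs' : List (MvPolynomial (Fin n × Fin n) (GenField n m')),
      IsNonscalarSeq gs' ∧ gs'.length ≤ gs.length + 3 ∧
        symmetrizedMatMulPoly (GenField n m') (Fin n) ∈ freeSpan {x | x ∈ gs'}

/-- Third step (shape only; everything in tree): Baur–Strassen on the POLYNOMIAL `tr(M³)`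
(`exists_isNonscalarSeq_forall_pderiv`, `∂ tr(M³)/∂m_{ij} = 3 (M²)_{ji}`), the cost-free block
substitution `M ↦ [[0, A], [B, 0]]` (`IsNonscalarSeq.aeval_append`; `M² = diag(AB, BA)`, BCS p. 463)
and `R ≤ 2 L^{ns}` (`exists_triads_of_isNonscalarSeq`). -/
def TraceCubeToRank : Prop :=
  ∀ (K : Type) [Field K] [CharZero K] (q N : ℕ)
    (gs : List (MvPolynomial (Fin (2 * q) × Fin (2 * q)) K)),
    IsNonscalarSeq gs → gs.length ≤ N →
    symmetrizedMatMulPoly K (Fin (2 * q)) ∈ freeSpan {x | x ∈ gs} →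
    tensorRank (matMulTensor K q q q) ≤ 6 * N

/-- Fourth step (shape only): rank does not rise when the scalars are restricted from the purely
transcendental extension `ℂ(Z)` back to `ℂ` (specialise the finitely many rational coefficients of
a decomposition at a point where their denominators do not vanish; `ℂ` infinite). -/
def RankDescent : Prop :=
  ∀ (σ : Type) [Fintype σ] [DecidableEq σ] (q r : ℕ),
    tensorRank (matMulTensor (FractionRing (MvPolynomial σ ℂ)) q q q) ≤ r →
    tensorRank (matMulTensor ℂ q q q) ≤ r

/-- Fifth step (shape only; bookkeeping over `admissibleExponents` / `omega = sInf`). -/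
def OmegaFromRank : Prop :=
  ∀ τ : ℝ, (∃ A : ℝ, ∃ q₀ : ℕ, ∀ q ≥ q₀,
      (tensorRank (matMulTensor ℂ q q q) : ℝ) ≤ A * (q : ℝ) ^ τ) → omega ℂ ≤ τ

/-! ### Cheapest falsifier, RUN: the Taylor hom at the tautological generic point is TOTAL

`φ : ℂ(Z) →+* ℂ(Z)⟦T⟧`, `z_i ↦ z_i + T_i`: every nonzero polynomial `p(Z)` goes to the power series
`p(Z + T)` whose constant coefficient is `p(Z) ≠ 0` in the FIELD `ℂ(Z)`, hence a unit
(`MvPowerSeries.isUnit_iff_constantCoeff`); so the hom extends from `ℂ[Z]` to all of `Frac ℂ[Z]`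
(`IsLocalization.lift`). PROVED below (`exists_taylorHom`), no sorry. -/

section TaylorHom

variable (σ : Type)

/-- The function field `ℂ(Z)`, `Z = (z_i)_{i ∈ σ}`. -/
abbrev Fn : Type := FractionRing (MvPolynomial σ ℂ)

/-- The substitution `z_i ↦ z_i + T_i` into polynomials over the function field. -/
def shiftSubst : MvPolynomial σ ℂ →ₐ[ℂ] MvPolynomial σ (Fn σ) :=
  aeval fun i => C (algebraMap (MvPolynomial σ ℂ) (Fn σ) (X i)) + X i

/-- `p(Z + T)` as a power series in `T` over `ℂ(Z)`. -/
def shiftSeries : MvPolynomial σ ℂ →+* MvPowerSeries σ (Fn σ) :=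
  (MvPolynomial.coeToMvPowerSeries.ringHom (σ := σ) (R := Fn σ)).comp (shiftSubst σ).toRingHom

/-- The constant coefficient of `p(Z + T)` is `p(Z)`. -/
theorem constantCoeff_shiftSeries (p : MvPolynomial σ ℂ) :
    MvPowerSeries.constantCoeff (shiftSeries σ p) = algebraMap (MvPolynomial σ ℂ) (Fn σ) p := by
  -- both sides are ring homs `ℂ[Z] → ℂ(Z)` agreeing on constants and variables
  have key : (MvPowerSeries.constantCoeff.comp (shiftSeries σ)) =
      (algebraMap (MvPolynomial σ ℂ) (Fn σ)) := by
    refine MvPolynomial.ringHom_ext (fun c => ?_) (fun i => ?_)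
    · simp [shiftSeries, shiftSubst]
      rfl
    · simp [shiftSeries, shiftSubst]
  exact RingHom.congr_fun key p

/-- Nonzero polynomials become units of `ℂ(Z)⟦T⟧`. -/
theorem isUnit_shiftSeries {p : MvPolynomial σ ℂ} (hp : p ≠ 0) : IsUnit (shiftSeries σ p) := by
  rw [MvPowerSeries.isUnit_iff_constantCoeff, constantCoeff_shiftSeries, isUnit_iff_ne_zero]
  exact fun h => hp (IsFractionRing.injective (MvPolynomial σ ℂ) (Fn σ) (by rw [h, map_zero]))

/-- **The Taylor hom at the tautological generic point is total**: a ring hom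
`φ : ℂ(Z) →+* ℂ(Z)⟦T⟧` with `φ(z_i) = z_i + T_i`. -/
theorem exists_taylorHom :
    ∃ φ : Fn σ →+* MvPowerSeries σ (Fn σ),
      ∀ i, φ (algebraMap (MvPolynomial σ ℂ) (Fn σ) (X i)) =
        MvPowerSeries.C (algebraMap (MvPolynomial σ ℂ) (Fn σ) (X i)) + MvPowerSeries.X i := by
  have hg : ∀ y : nonZeroDivisors (MvPolynomial σ ℂ), IsUnit (shiftSeries σ y) := fun y =>
    isUnit_shiftSeries σ (nonZeroDivisors.ne_zero y.2)
  refine ⟨IsLocalization.lift (M := nonZeroDivisors (MvPolynomial σ ℂ)) hg, fun i => ?_⟩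
  rw [IsLocalization.lift_eq hg]
  simp [shiftSeries, shiftSubst]

end TaylorHom

/-- Elaboration witnesses only (no proofs at the ideation stage). -/
example : JetTransport → TaylorTransport → CubicToTraceCube → TraceCubeToRank → RankDescent →
    OmegaFromRank → True := fun _ _ _ _ _ _ => trivial

end Summit.MatrixMultiplication.MatrixMultiplication.Cruxes.DerivationsBoundOmega.CubicJet

end
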